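import Summits.KontsevichZagierPeriods.KontsevichZagierPeriods.Theses.LinRedNormalForm
import Literature.NumberTheory.Transcendental.KZKernelConjectureForms
import Literature.NumberTheory.Transcendental.KZRelationsLE
import Literature.NumberTheory.Transcendental.KZUnfolding
import Literature.NumberTheory.Transcendental.MZVSimplexRepProofs
import Literature.NumberTheory.Transcendental.MultipleZetaHoffmanRelationProofs
import Literature.NumberTheory.Transcendental.MultipleZetaEulerProofs
import Literature.NumberTheory.Transcendental.MultipleZetaValuesProofs
import Literature.NumberTheory.Transcendental.MultipleZetaWeightFiveProofs

/-!
# `MzvKernelInKZ` (stmt-KontsevichZagierPeriods-3914): negative side — the generators, shape of any refutation, load-bearing hypotheses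

Negative-side support for the crux `MzvKernelInKZ` of route `LinRedNormalForm` (cdisprove unit,
refuter seats `refuter-cdisprove-stmt-KontsevichZagierPeriods-3914-*`; running commentary and
near-misses in the work file `Cruxes/MzvKernelInKZ/Disproof.lean`).  The crux: every
`ℤ`-combination of MZV word representations `[Δ_w, q · ∏ᵢ ω_{εᵢ}(tᵢ)]` (Kontsevich's iterated
integrals, Kontsevich–Zagier 2001, §1.1) with value `0` lies in `KZ.relations`.  Nothing here
refutes it.  This file records, as theorems the other seats can import:

* §0 the generating set `genSet` named and the read-back `crux_iff` (`Iff.rfl`);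
* §1 the shape of any refutation: `not_summit_of_not` (a refutation of the crux is a refutation of
  Conjecture 1 as formalised) and the template `not_of_separating_invariant` (an additive invariant
  finer than `eval` vanishing on the four move sets — i.e. a non-motivic MZV relation);
* §2–§3 the generators made explicit (`Adm`, `wordFun`, `wordRep`, values, bookkeeping modulo
  relations: `of_wordRep_add`, `of_wordRep_neg`, `of_wordRep_smul_of`, off-domain freedom
  `of_sub_of_wordRep_mem_relations`) and the LOAD-BEARING ANALYSIS: `not_withoutEval` (drop
  `eval c = 0`: false, witness `[pt, 1]`) and `withoutClosure_iff_summit` (drop the restriction to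
  the MZV closure: this IS the summit).

Companion files in this directory: `Duality.lean` (duality is one move), `Engine.lean` (per-weight
rungs and the finite-rank engine), `WeightsTwoThree.lean`, `WeightFour.lean` (the rungs `w ≤ 4`
reduced to typed memberships), `Divergence.lean` (non-admissible words carry no representation),
`Transfer.lean` (all-weights transfer theorem and strength), `WeightFive.lean`.

Sources: M. Kontsevich, D. Zagier, *Periods* (2001), §§1.1–1.2; D. Zagier, *Values of zeta
functions and their applications* (1994), §9. -/

noncomputable section

namespace Summit.KontsevichZagierPeriods.MzvKernelInKZ.Negative

open Set MeasureTheory MvPolynomial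
open Literature.NumberTheory.Transcendental
open Summit.KontsevichZagierPeriods.KontsevichZagierPeriods.Theses.LinRedNormalForm (MzvKernelInKZ)

/-! ## §0 The crux, its generating set named -/

/-- The open ordered simplex `{1 > t₀ > ⋯ > t_{w-1} > 0}`, literally as inlined in the crux
(definitionally `KZ.openOrderedSimplex w`). [folklore] -/
def simplex (w : ℕ) : Set (Fin w → ℝ) := {t | (∀ i, 0 < t i) ∧ (∀ i, t i < 1) ∧ StrictAnti t}

/-- The inlined simplex of the crux is the tree's `KZ.openOrderedSimplex` (definitional). [folklore] -/
theorem simplex_eq_openOrderedSimplex (w : ℕ) : simplex w = KZ.openOrderedSimplex w := rfl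

/-- The word integrand `q · ∏ᵢ ω_{εᵢ}(tᵢ)`, literally as inlined in the crux. [folklore] -/
def wordFun {w : ℕ} (ε : Fin w → Bool) (q : ℚ) (t : Fin w → ℝ) : ℝ :=
  (q : ℝ) * ∏ i, if ε i then 1 / (1 - t i) else 1 / t i

/-- The generating set of the crux: all MZV word representations. [folklore] -/
def genSet : Set KZ.FormalRep :=
  {x | ∃ (w : ℕ) (ε : Fin w → Bool) (q : ℚ) (s : KZ.IntegralRep w),
    s.domain = {t | (∀ i, 0 < t i) ∧ (∀ i, t i < 1) ∧ StrictAnti t} ∧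
    EqOn s.integrand (fun t => (q : ℝ) * ∏ i, if ε i then 1 / (1 - t i) else 1 / t i) s.domain ∧
    x = KZ.of s}

/-- Read-back: the crux is the kernel statement on `AddSubgroup.closure genSet` (by `Iff.rfl`). [folklore] -/
theorem crux_iff :
    MzvKernelInKZ ↔ ∀ c ∈ AddSubgroup.closure genSet, KZ.eval c = 0 → c ∈ KZ.relations :=
  Iff.rfl

/-! ## §1 Shape of any refutation: the crux follows from the summit -/

/-- Any refutation of the crux refutes the kernel conjecture `ker eval = relations`
(`KZKernelConjecture`), of which the crux is the restriction to the MZV closure. [folklore] -/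
theorem not_kzKernelConjecture_of_not (h : ¬ MzvKernelInKZ) : ¬ KZKernelConjecture :=
  fun hK => h fun c _ hc => hK c hc

/-- Any refutation of the crux refutes the summit (Conjecture 1 as formalised), via the proved
equivalence `kzKernelConjecture_iff_isRational` of the kernel form with the two-representation
form: there is no refutation cheaper than a counterexample to Conjecture 1 on the MZV sector.
[folklore] -/
theorem not_summit_of_not (h : ¬ MzvKernelInKZ) : ¬ _root_.KontsevichZagierPeriods :=
  fun hs => not_kzKernelConjecture_of_not h (kzKernelConjecture_iff_isRational.mpr hs)

/-- TEMPLATE of a refutation: an additive invariant `J` vanishing on the four move sets and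
non-zero on some element of the MZV closure with value `0`. (Soundness makes `eval` itself such an
invariant except for the last clause; `J` must see more than the value — a "non-motivic" datum.)
[folklore] -/
theorem not_of_separating_invariant {A : Type*} [AddCommGroup A] (J : KZ.FormalRep →+ A)
    (hJ : ∀ x ∈ KZ.domainAddRel ∪ KZ.integrandAddRel ∪ KZ.changeOfVariablesRel ∪ KZ.newtonLeibnizRel,
      J x = 0)
    (c : KZ.FormalRep) (hc : c ∈ AddSubgroup.closure genSet) (hc0 : KZ.eval c = 0) (hJc : J c ≠ 0) :
    ¬ MzvKernelInKZ := by
  intro h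
  have hker : KZ.relations ≤ J.ker := (AddSubgroup.closure_le _).mpr fun x hx => hJ x hx
  exact hJc (hker (h c hc hc0))

/-! ## §2 Load-bearing hypotheses -/

/-- The crux with the hypothesis `eval c = 0` dropped (refuted below: `not_withoutEval`). -/
def WithoutEval : Prop := ∀ c ∈ AddSubgroup.closure genSet, c ∈ KZ.relations

/-- The crux with the restriction to the MZV closure dropped: the full kernel conjecture. -/
def WithoutClosure : Prop := ∀ c : KZ.FormalRep, KZ.eval c = 0 → c ∈ KZ.relations

/-- Dropping the closure restriction gives the kernel conjecture `KZKernelConjecture` verbatim.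
[folklore] -/
theorem withoutClosure_iff_kzKernelConjecture : WithoutClosure ↔ KZKernelConjecture := Iff.rfl

/-- Dropping the closure restriction gives exactly the summit (kernel form ⟺ Conjecture 1,
`kzKernelConjecture_iff_isRational`). [folklore] -/
theorem withoutClosure_iff_summit : WithoutClosure ↔ _root_.KontsevichZagierPeriods :=
  kzKernelConjecture_iff_isRational

/-! ## §3 The generators, explicitly -/

section Generators

variable {w : ℕ}

/-- Admissible letters: empty word, or first letter `0` (form `dt/t` at the largest variable) and
last letter `1` (form `dt/(1-t)` at the smallest) — the convergence condition. Non-admissible words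
admit NO integrable representation with `q ≠ 0`, so they contribute only zero representations
(which are relations); the rungs below are therefore stated over admissible letters. -/
def Adm (ε : Fin w → Bool) : Prop :=
  ∀ h : 0 < w, ε ⟨0, h⟩ = false ∧ ε ⟨w - 1, Nat.sub_one_lt_of_lt h⟩ = true

/-- Admissibility of a word is decidable (finitely many Boolean letters). [folklore] -/
instance (ε : Fin w → Bool) : Decidable (Adm ε) := by
  unfold Adm; infer_instance

/-- The word integrand is the quotient of `ℚ`-polynomials `q / ∏ᵢ pᵢ`, `pᵢ = 1 - Xᵢ` or `Xᵢ`. [folklore] -/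
theorem wordFun_eq_aeval_div (ε : Fin w → Bool) (q : ℚ) (t : Fin w → ℝ) :
    wordFun ε q t = aeval t (C q : MvPolynomial (Fin w) ℚ) /
      aeval t (∏ i : Fin w, (if ε i then 1 - X i else X i : MvPolynomial (Fin w) ℚ)) := by
  simp only [wordFun, map_prod, aeval_C, eq_ratCast, div_eq_mul_inv, ← Finset.prod_inv_distrib]
  refine congrArg (fun x => (q : ℝ) * x) (Finset.prod_congr rfl fun i _ => ?_)
  split_ifs <;> simp

/-- The denominator `∏ᵢ pᵢ` (`pᵢ = 1 − Xᵢ` or `Xᵢ`) of the word integrand does not vanish on the simplex. [folklore] -/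
theorem aeval_prod_ne_zero {ε : Fin w → Bool} {t : Fin w → ℝ} (ht : t ∈ simplex w) :
    aeval t (∏ i : Fin w, (if ε i then 1 - X i else X i : MvPolynomial (Fin w) ℚ)) ≠ 0 := by
  obtain ⟨h0, h1, -⟩ := ht
  rw [map_prod]
  refine Finset.prod_ne_zero_iff.mpr fun i _ => ?_
  split_ifs
  · simpa [sub_eq_zero] using (h1 i).ne'
  · simpa using (h0 i).ne'

/-- The word integrand is `ℚ`-semialgebraic on the simplex. [folklore] -/
theorem isSemialgebraicFunOn_wordFun (ε : Fin w → Bool) (q : ℚ) :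
    IsSemialgebraicFunOn ℚ (simplex w) (wordFun ε q) := by
  refine (isSemialgebraicFunOn_aeval_div_aeval (KZ.isSemialgebraic_openOrderedSimplex w) (C q) _
    fun t ht => aeval_prod_ne_zero (ε := ε) ht).congr ?_
  intro t _
  exact (wordFun_eq_aeval_div ε q t).symm

/-- The word integrand with `q = 1` is the tree's product of forms `KZ.mzvForm`. [folklore] -/
theorem wordFun_one_eq_prod_mzvForm (ε : Fin w → Bool) (t : Fin w → ℝ) :
    wordFun ε 1 t = ∏ i, KZ.mzvForm (ε i) (t i) := by
  simp only [wordFun, Rat.cast_one, one_mul, KZ.mzvForm]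

/-- `wordFun ε q = q · wordFun ε 1` pointwise. [folklore] -/
theorem wordFun_eq_mul_wordFun_one (ε : Fin w → Bool) (q : ℚ) (t : Fin w → ℝ) :
    wordFun ε q t = (q : ℝ) * wordFun ε 1 t := by
  simp [wordFun]

/-- Absolute convergence for admissible letters (the tree's domination lemma
`KZ.integrableOn_prod_mzvForm`). [folklore] -/
theorem integrableOn_wordFun {ε : Fin w → Bool} (hε : Adm ε) (q : ℚ) :
    IntegrableOn (wordFun ε q) (simplex w) volume := by
  -- extend the letters to `ℕ`
  let ε' : ℕ → Bool := fun k => if h : k < w then ε ⟨k, h⟩ else false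
  have h1 : IntegrableOn (fun t : Fin w → ℝ => ∏ i : Fin w, KZ.mzvForm (ε' i) (t i))
      (KZ.openOrderedSimplex w) volume := by
    refine KZ.integrableOn_prod_mzvForm w ε' (fun hw => ?_) (fun hw => ?_)
    · simp [ε', hw, (hε hw).1]
    · have : w - 1 < w := Nat.sub_one_lt_of_lt hw
      simp [ε', this, (hε hw).2]
  have h2 : (fun t : Fin w → ℝ => ∏ i : Fin w, KZ.mzvForm (ε' i) (t i)) = wordFun ε 1 := by
    funext t
    rw [wordFun_one_eq_prod_mzvForm]
    refine Finset.prod_congr rfl fun i _ => ?_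
    simp [ε', i.isLt]
  rw [h2] at h1
  have h3 : wordFun ε q = fun t => (q : ℝ) * wordFun ε 1 t := funext (wordFun_eq_mul_wordFun_one ε q)
  rw [h3]
  exact h1.const_mul _

/-- **The canonical word representation** `[Δ_w, q · ∏ ω_ε]` for admissible letters. Any two
`IntegralRep`s with this domain and this integrand function are equal (proof irrelevance), so this
is a canonical form for the generators up to off-domain values of the integrand. [folklore] -/
def wordRep (ε : Fin w → Bool) (q : ℚ) (hε : Adm ε) : KZ.IntegralRep w where
  domain := simplex w
  integrand := wordFun ε q
  isSemialgebraic_domain := KZ.isSemialgebraic_openOrderedSimplex w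
  isSemialgebraicFunOn_integrand := isSemialgebraicFunOn_wordFun ε q
  integrableOn := integrableOn_wordFun hε q

/-- The domain of a canonical word representation is the simplex. [folklore] -/
@[simp] theorem wordRep_domain (ε : Fin w → Bool) (q : ℚ) (hε : Adm ε) :
    (wordRep ε q hε).domain = simplex w := rfl

/-- The integrand of a canonical word representation is the word integrand. [folklore] -/
@[simp] theorem wordRep_integrand (ε : Fin w → Bool) (q : ℚ) (hε : Adm ε) :
    (wordRep ε q hε).integrand = wordFun ε q := rfl

/-- The canonical word representations are generators of the crux. [folklore] -/
theorem of_wordRep_mem_genSet (ε : Fin w → Bool) (q : ℚ) (hε : Adm ε) :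
    KZ.of (wordRep ε q hε) ∈ genSet :=
  ⟨w, ε, q, wordRep ε q hε, rfl, fun _ _ => rfl, rfl⟩

/-- The canonical word representations lie in the MZV closure. [folklore] -/
theorem of_wordRep_mem_closure (ε : Fin w → Bool) (q : ℚ) (hε : Adm ε) :
    KZ.of (wordRep ε q hε) ∈ AddSubgroup.closure genSet :=
  AddSubgroup.subset_closure (of_wordRep_mem_genSet ε q hε)

/-- Values scale: `value [Δ, q ω] = q · value [Δ, ω]`. [folklore] -/
theorem value_wordRep (ε : Fin w → Bool) (q : ℚ) (hε : Adm ε) :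
    (wordRep ε q hε).value = (q : ℝ) * (wordRep ε 1 hε).value := by
  simp only [KZ.IntegralRep.value, wordRep_domain, wordRep_integrand]
  rw [← integral_const_mul]
  exact integral_congr_ae (Filter.Eventually.of_forall fun t => wordFun_eq_mul_wordFun_one ε q t)

/-! ### Congruence and bookkeeping modulo relations -/

/-- A representation whose integrand vanishes on its domain is a relation. [folklore] -/
theorem of_mem_relations_of_eqOn_zero {n : ℕ} (r : KZ.IntegralRep n)
    (h : EqOn r.integrand 0 r.domain) : KZ.of r ∈ KZ.relations :=
  KZ.levelRel_le_relations (KZ.of_mem_levelRel_of_eqOn_zero r h)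

/-- The zero word representation is a relation. [folklore] -/
theorem of_wordRep_zero_mem_relations (ε : Fin w → Bool) (hε : Adm ε) :
    KZ.of (wordRep ε 0 hε) ∈ KZ.relations :=
  of_mem_relations_of_eqOn_zero _ fun t _ => by simp [wordFun]

/-- **Congruence** (off-domain freedom): two representations with the same domain whose
integrands agree ON the domain differ by a relation (integrand additivity against a zero
representation). In particular every generator of the crux with admissible letters is
`≡ [wordRep ε q]` modulo relations. [folklore] -/
theorem of_sub_of_mem_relations_of_eqOn {n : ℕ} {r r' : KZ.IntegralRep n}
    (hd : r'.domain = r.domain) (h : EqOn r.integrand r'.integrand r.domain) :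
    KZ.of r - KZ.of r' ∈ KZ.relations := by
  let z : KZ.IntegralRep n :=
    ⟨r.domain, 0, r.isSemialgebraic_domain,
      (isSemialgebraicFunOn_aeval r.isSemialgebraic_domain 0).congr fun x _ => by simp,
      integrableOn_zero⟩
  have h1 : KZ.of r - KZ.of r' - KZ.of z ∈ KZ.relations :=
    KZ.integrandAddRel_subset_relations ⟨n, r, r', z, hd, rfl, fun x hx => by
      simp [z, h hx], rfl⟩
  have h2 : KZ.of z ∈ KZ.relations := of_mem_relations_of_eqOn_zero z (fun _ _ => rfl)
  have : KZ.of r - KZ.of r' = (KZ.of r - KZ.of r' - KZ.of z) + KZ.of z := by abel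
  rw [this]
  exact KZ.relations.add_mem h1 h2

/-- Every generator with admissible letters is congruent to the canonical word representation. [folklore] -/
theorem of_sub_of_wordRep_mem_relations {ε : Fin w → Bool} {q : ℚ} (hε : Adm ε)
    (s : KZ.IntegralRep w) (hd : s.domain = simplex w)
    (hi : EqOn s.integrand (fun t => (q : ℝ) * ∏ i, if ε i then 1 / (1 - t i) else 1 / t i)
      s.domain) :
    KZ.of s - KZ.of (wordRep ε q hε) ∈ KZ.relations :=
  of_sub_of_mem_relations_of_eqOn (by simp [hd]) fun t ht => hi ht

/-- Integrand additivity on word representations: `[Δ,(q₁+q₂)ω] − [Δ,q₁ω] − [Δ,q₂ω]` is ONE move. [folklore] -/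
theorem of_wordRep_add (ε : Fin w → Bool) (q₁ q₂ : ℚ) (hε : Adm ε) :
    KZ.of (wordRep ε (q₁ + q₂) hε) - KZ.of (wordRep ε q₁ hε) - KZ.of (wordRep ε q₂ hε) ∈
      KZ.relations :=
  KZ.integrandAddRel_subset_relations ⟨w, wordRep ε (q₁ + q₂) hε, wordRep ε q₁ hε,
    wordRep ε q₂ hε, rfl, rfl, fun t _ => by
      simp only [wordRep_integrand, Pi.add_apply, wordFun, Rat.cast_add]; ring, rfl⟩

/-- `[Δ, qω] + [Δ, (−q)ω]` is a relation (two moves). [folklore] -/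
theorem of_wordRep_neg (ε : Fin w → Bool) (q : ℚ) (hε : Adm ε) :
    KZ.of (wordRep ε q hε) + KZ.of (wordRep ε (-q) hε) ∈ KZ.relations := by
  have h1 := of_wordRep_add ε q (-q) hε
  have h2 := of_wordRep_zero_mem_relations ε hε
  rw [show q + -q = 0 by ring] at h1
  have : KZ.of (wordRep ε q hε) + KZ.of (wordRep ε (-q) hε) =
      KZ.of (wordRep ε 0 hε) - (KZ.of (wordRep ε 0 hε) - KZ.of (wordRep ε q hε) -
        KZ.of (wordRep ε (-q) hε)) := by abel
  rw [this]
  exact KZ.relations.sub_mem h2 h1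

/-- Rational constants are algebraic. [folklore] -/
theorem isAlgebraic_ratCast (q : ℚ) : IsAlgebraic ℚ (q : ℝ) := isAlgebraic_algebraMap q

/-- **Rational rescaling of a relation between word representations is a relation** (the scaling
endomorphism `KZ.scale` preserves relations; no division by integers is ever needed). [folklore] -/
theorem of_wordRep_smul_of {w' : ℕ} {ε : Fin w → Bool} {ε' : Fin w' → Bool} (hε : Adm ε)
    (hε' : Adm ε') {a b : ℚ}
    (h : KZ.of (wordRep ε a hε) - KZ.of (wordRep ε' b hε') ∈ KZ.relations) (q : ℚ) :
    KZ.of (wordRep ε (q * a) hε) - KZ.of (wordRep ε' (q * b) hε') ∈ KZ.relations := by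
  have hs := KZ.scale_mem_relations (q : ℝ) (isAlgebraic_ratCast q) h
  rw [map_sub, KZ.scale_of, KZ.scale_of] at hs
  have e1 : KZ.of ((wordRep ε a hε).constMul (q : ℝ) (isAlgebraic_ratCast q)) -
      KZ.of (wordRep ε (q * a) hε) ∈ KZ.relations :=
    of_sub_of_mem_relations_of_eqOn rfl fun t _ => by
      simp only [KZ.IntegralRep.integrand_constMul, wordRep_integrand, wordFun, Rat.cast_mul]
      ring
  have e2 : KZ.of ((wordRep ε' b hε').constMul (q : ℝ) (isAlgebraic_ratCast q)) -
      KZ.of (wordRep ε' (q * b) hε') ∈ KZ.relations :=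
    of_sub_of_mem_relations_of_eqOn rfl fun t _ => by
      simp only [KZ.IntegralRep.integrand_constMul, wordRep_integrand, wordFun, Rat.cast_mul]
      ring
  have : KZ.of (wordRep ε (q * a) hε) - KZ.of (wordRep ε' (q * b) hε') =
      (KZ.of ((wordRep ε a hε).constMul (q : ℝ) (isAlgebraic_ratCast q)) -
        KZ.of ((wordRep ε' b hε').constMul (q : ℝ) (isAlgebraic_ratCast q))) -
      (KZ.of ((wordRep ε a hε).constMul (q : ℝ) (isAlgebraic_ratCast q)) -
        KZ.of (wordRep ε (q * a) hε)) +
      (KZ.of ((wordRep ε' b hε').constMul (q : ℝ) (isAlgebraic_ratCast q)) -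
        KZ.of (wordRep ε' (q * b) hε')) := by abel
  rw [this]
  exact KZ.relations.add_mem (KZ.relations.sub_mem hs e1) e2

end Generators

/-! ### The weight-zero generator `[pt, q]` and `not_withoutEval` -/

/-- The empty word (weight `0`): the rational constant `q` as a zero-dimensional representation. [folklore] -/
def emptyWordRep (q : ℚ) : KZ.IntegralRep 0 := wordRep (w := 0) Fin.elim0 q (fun h => absurd h (by decide))

/-- In dimension `0` the simplex is the whole one-point space `ℝ⁰`. [folklore] -/
theorem simplex_zero : simplex 0 = univ := by
  ext t
  simp only [simplex, mem_setOf_eq, IsEmpty.forall_iff, true_and, mem_univ, iff_true]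
  intro a b hab
  exact a.elim0

/-- `value [pt, q] = q`: `ℝ⁰` is one point of Lebesgue volume `1`. [folklore] -/
theorem value_emptyWordRep (q : ℚ) : (emptyWordRep q).value = q := by
  simp only [KZ.IntegralRep.value, emptyWordRep, wordRep_domain, wordRep_integrand, simplex_zero,
    Measure.restrict_univ]
  obtain ⟨x, hx⟩ : ∃ x : Fin 0 → ℝ, (volume : Measure (Fin 0 → ℝ)) = Measure.dirac x :=
    ⟨_, by rw [volume_pi, Measure.pi_of_empty]⟩
  rw [hx, integral_dirac]
  simp [wordFun]

/-- **Load-bearing: `eval c = 0` cannot be dropped.** `[pt, 1]` lies in the MZV closure and is not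
a relation (relations evaluate to `0`, soundness). [folklore] -/
theorem not_withoutEval : ¬ WithoutEval := by
  intro h
  have h1 := h _ (of_wordRep_mem_closure (w := 0) Fin.elim0 1 (fun h => absurd h (by decide)))
  have h2 : KZ.eval (KZ.of (emptyWordRep 1)) = 0 :=
    (AddMonoidHom.mem_ker).1 (KZ.relations_le_ker_eval_holds h1)
  rw [KZ.eval_of, value_emptyWordRep] at h2
  norm_num at h2

end Summit.KontsevichZagierPeriods.MzvKernelInKZ.Negative
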